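import Literature.NumberTheory.Automorphic.QuadraticLatticesIdelic
import Literature.NumberTheory.Automorphic.QuadraticIrrationalForms
import HarnessLib

/-!
# `h(B) = h(disc B)`: idele classes of a quadratic order and classes of primitive forms

Topic `NumberTheory/Automorphic`; definitions with bodies and theorems (no named fact, no
`sorry`). Tenth brick of the Brandt-module side of the Eichler–Pizer trace identity: for an
order `B = ℤ[σ]` (`σ = r₀ + γ/m`, `σ² = tσ - n`) of the imaginary quadratic field `ℚ(γ)` inside a
division quaternion algebra, the idelic class number `classNumber γ B` equals the form class
number `BinQF.classNumber (t² - 4n)` (Cox Thm. 7.7 for an arbitrary order, with invertible =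
locally principal ideals; Thm. 2.8 for the count by reduced forms).

* lattices `[1, τ]`: `isLocPrin_span_pair` (`[1, τ]` is locally principal for `ℤ[aτ]`, Cox
  Prop. 7.4 / Lemma 7.5 locally), `isLocPrin_iff_eq_span` (`[1, τ]` is locally `B`-principal iff
  `B = ℤ[aτ]`), Möbius ↔ homothety (`span_pair_moeb`, `exists_moeb_of_span_eq_smul`);
* `PicHyp` (the setting), `PicHyp.exists_eq_smul_span_pair` (every lattice of `ℚ(γ)` is
  `c [1, τ]`), the form class map `PicHyp.classMap : LatClass γ B → FormClass (t² - 4n)`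
  (`[c [1, τ]] ↦ [oform τ]`), `classMap_bijective`, `card_formClass` (`#C(Δ) = h(Δ)` by reduced
  forms), and `PicHyp.classNumber_eq` — **`classNumber γ B = h(t² - 4n)`**.

## References

* D. A. Cox, *Primes of the form x² + ny²*, 2nd ed. (2013), §7.A Prop. 7.4, §7.B Lemma 7.5,
  Thm. 7.7 and its proof, Exercise 7.9; §2.A Thm. 2.8 [Cox2013].
-/

noncomputable section

open scoped Pointwise
open Literature.NumberTheory.QuadraticFields.Quadratic

universe u

namespace Literature.NumberTheory.Automorphic

namespace Brandt

variable {D : Type u} [Ring D] [Algebra ℚ D] [IsQuaternionAlgebra ℚ D] {γ τ : D} {B : Submodule ℤ D}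

/-! ### Pairs spanning the same lattice -/

omit [IsQuaternionAlgebra ℚ D] [Algebra ℚ D] in
/-- Two pairs generating each other span the same `ℤ`-lattice. [folklore] -/
theorem span_pair_eq_span_pair {x y x' y' : D} (h1 : x' ∈ Submodule.span ℤ {x, y})
    (h2 : y' ∈ Submodule.span ℤ {x, y}) (h3 : x ∈ Submodule.span ℤ {x', y'})
    (h4 : y ∈ Submodule.span ℤ {x', y'}) :
    Submodule.span ℤ ({x', y'} : Set D) = Submodule.span ℤ {x, y} := by
  apply le_antisymm
  · rw [Submodule.span_le]
    rintro z (rfl | rfl)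
    · exact h1
    · exact h2
  · rw [Submodule.span_le]
    rintro z (rfl | rfl)
    · exact h3
    · exact h4

omit [IsQuaternionAlgebra ℚ D] [Algebra ℚ D] in
/-- `u x + v y ∈ [x, y]` for integers `u, v`. [folklore] -/
theorem zsmul_add_zsmul_mem_span_pair (x y : D) (u v : ℤ) : u • x + v • y ∈ Submodule.span ℤ ({x, y} : Set D) :=
  Submodule.mem_span_pair.mpr ⟨u, v, rfl⟩

omit [IsQuaternionAlgebra ℚ D] [Algebra ℚ D] in
/-- `1 ∈ [1, τ]`. [folklore] -/
theorem one_mem_span_pair (τ : D) : (1 : D) ∈ Submodule.span ℤ ({1, τ} : Set D) :=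
  Submodule.subset_span (Set.mem_insert _ _)

omit [IsQuaternionAlgebra ℚ D] [Algebra ℚ D] in
/-- `τ ∈ [1, τ]`. [folklore] -/
theorem right_mem_span_pair (τ : D) : τ ∈ Submodule.span ℤ ({1, τ} : Set D) :=
  Submodule.subset_span (Set.mem_insert_of_mem _ (Set.mem_singleton _))

omit [IsQuaternionAlgebra ℚ D] [Algebra ℚ D] in
/-- `[1, -τ] = [1, τ]`. [folklore] -/
theorem span_one_neg (τ : D) : Submodule.span ℤ ({1, -τ} : Set D) = Submodule.span ℤ {1, τ} := by
  refine span_pair_eq_span_pair (one_mem_span_pair τ) (Submodule.neg_mem _ (right_mem_span_pair τ))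
    (one_mem_span_pair (-τ)) ?_
  have h := Submodule.neg_mem _ (right_mem_span_pair (-τ))
  rwa [neg_neg] at h

omit [IsQuaternionAlgebra ℚ D] [Algebra ℚ D] in
/-- `[1, τ + k] = [1, τ]` for an integer `k`. [folklore] -/
theorem span_one_add_int (τ : D) (k : ℤ) :
    Submodule.span ℤ ({1, τ + (k : D)} : Set D) = Submodule.span ℤ {1, τ} := by
  refine span_pair_eq_span_pair (one_mem_span_pair τ) ?_ (one_mem_span_pair _) ?_
  · have h := zsmul_add_zsmul_mem_span_pair (1 : D) τ k 1
    rwa [zsmul_one, one_smul, add_comm] at h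
  · have h := zsmul_add_zsmul_mem_span_pair (1 : D) (τ + (k : D)) (-k) 1
    have e : (-k) • (1 : D) + (1 : ℤ) • (τ + (k : D)) = τ := by
      rw [neg_smul, zsmul_one, one_smul]; abel
    rwa [e] at h

omit [IsQuaternionAlgebra ℚ D] [Algebra ℚ D] in
/-- `[1, kτ + j] = [1, kτ]`. [folklore] -/
theorem span_one_zsmul_add_int (τ : D) (k j : ℤ) :
    Submodule.span ℤ ({1, k • τ + (j : D)} : Set D) = Submodule.span ℤ {1, k • τ} :=
  span_one_add_int (k • τ) j

omit [IsQuaternionAlgebra ℚ D] [Algebra ℚ D] in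
/-- **Unimodular change of basis**: `[rτ + s, pτ + q] = [1, τ]` when `ps - qr = ±1`. [folklore] -/
theorem span_pair_unimodular (τ : D) {p q r s : ℤ} (hdet : p * s - q * r = 1 ∨ p * s - q * r = -1) :
    Submodule.span ℤ ({r • τ + s • (1 : D), p • τ + q • (1 : D)} : Set D) = Submodule.span ℤ {1, τ} := by
  set x : D := r • τ + s • (1 : D) with hx
  set y : D := p • τ + q • (1 : D) with hy
  refine span_pair_eq_span_pair ?_ ?_ ?_ ?_
  · rw [hx, add_comm]; exact zsmul_add_zsmul_mem_span_pair _ _ _ _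
  · rw [hy, add_comm]; exact zsmul_add_zsmul_mem_span_pair _ _ _ _
  · rcases hdet with h | h
    · have e : p • x + (-r) • y = (1 : D) := by rw [hx, hy]; match_scalars <;> linarith [h]
      rw [← e]; exact zsmul_add_zsmul_mem_span_pair _ _ _ _
    · have e : (-p) • x + r • y = (1 : D) := by rw [hx, hy]; match_scalars <;> linarith [h]
      rw [← e]; exact zsmul_add_zsmul_mem_span_pair _ _ _ _
  · rcases hdet with h | h
    · have e : (-q) • x + s • y = τ := by rw [hx, hy]; match_scalars <;> linarith [h]
      rw [← e]; exact zsmul_add_zsmul_mem_span_pair _ _ _ _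
    · have e : q • x + (-s) • y = τ := by rw [hx, hy]; match_scalars <;> linarith [h]
      rw [← e]; exact zsmul_add_zsmul_mem_span_pair _ _ _ _

omit [IsQuaternionAlgebra ℚ D] [Algebra ℚ D] in
/-- `c • [x, y] = [cx, cy]` for a unit `c`. [folklore] -/
theorem units_smul_span_pair (c : Dˣ) (x y : D) :
    c • Submodule.span ℤ ({x, y} : Set D) = Submodule.span ℤ {(c : D) * x, (c : D) * y} := by
  rw [Units.smul_def, Submodule.smul_span, Set.smul_set_insert, Set.smul_set_singleton, smul_eq_mul, smul_eq_mul]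

/-! ### Local principality of `[1, τ]` -/

omit [IsQuaternionAlgebra ℚ D] [Algebra ℚ D] in
/-- `[1, τ]_(q) = [1, kτ]_(q)` for `k` prime to `q`. [folklore] -/
theorem localAt_span_one_zsmul {q : ℕ} {k : ℤ} (hk0 : k ≠ 0) (hk : k.natAbs.Coprime q) (τ : D) :
    localAt q (Submodule.span ℤ ({1, τ} : Set D)) = localAt q (Submodule.span ℤ {1, k • τ}) := by
  apply le_antisymm
  · -- `k τ ∈ [1, kτ]`, so `τ ∈ [1, kτ]_(q)`
    have hτ : τ ∈ localAt q (Submodule.span ℤ ({1, k • τ} : Set D)) := by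
      refine mem_localAt_of_smul_mem (Int.natAbs_ne_zero.mpr hk0) hk ?_
      rcases Int.natAbs_eq k with h | h
      · rw [← h]; exact right_mem_span_pair _
      · rw [show ((k.natAbs : ℕ) : ℤ) = -k by omega, neg_smul]
        exact Submodule.neg_mem _ (right_mem_span_pair _)
    calc localAt q (Submodule.span ℤ ({1, τ} : Set D))
        ≤ localAt q (localAt q (Submodule.span ℤ ({1, k • τ} : Set D))) := by
          refine localAt_mono q (Submodule.span_le.mpr ?_)
          rintro z (rfl | rfl)
          · exact le_localAt q _ (one_mem_span_pair _)
          · exact hτ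
      _ = _ := localAt_localAt q _
  · refine localAt_mono q (Submodule.span_le.mpr ?_)
    rintro z (rfl | rfl)
    · exact one_mem_span_pair _
    · exact Submodule.smul_mem _ _ (right_mem_span_pair _)

omit [IsQuaternionAlgebra ℚ D] [Algebra ℚ D] in
/-- `[1, θ]` is closed under multiplication when `θ² ∈ [1, θ]`. [folklore] -/
theorem mul_mem_span_pair_of_sq_mem {θ : D} (hθ : θ * θ ∈ Submodule.span ℤ ({1, θ} : Set D)) :
    ∀ x ∈ Submodule.span ℤ ({1, θ} : Set D), ∀ y ∈ Submodule.span ℤ ({1, θ} : Set D),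
      x * y ∈ Submodule.span ℤ ({1, θ} : Set D) := by
  intro x hx y hy
  obtain ⟨u, v, rfl⟩ := Submodule.mem_span_pair.mp hx
  obtain ⟨u', v', rfl⟩ := Submodule.mem_span_pair.mp hy
  have : (u • (1 : D) + v • θ) * (u' • (1 : D) + v' • θ) =
      (u * u') • (1 : D) + (u * v' + v * u') • θ + (v * v') • (θ * θ) := by
    simp only [add_mul, mul_add, smul_mul_assoc, mul_smul_comm, one_mul, mul_one]
    module
  rw [this]
  exact Submodule.add_mem _ (zsmul_add_zsmul_mem_span_pair _ _ _ _) (Submodule.smul_mem _ _ hθ)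

omit [IsQuaternionAlgebra ℚ D] [Algebra ℚ D] in
/-- `ℤ[aτ] = [1, aτ]` is a ring when `aτ² + bτ + c = 0`. [cite: Cox2013, §7.B Lemma 7.5] -/
theorem sq_mem_span_pair_of_root {τ : D} {a b c : ℤ} (hroot : a • (τ * τ) + b • τ + c • (1 : D) = 0) :
    (a • τ) * (a • τ) ∈ Submodule.span ℤ ({1, a • τ} : Set D) := by
  have : (a • τ) * (a • τ) = (-(a * c)) • (1 : D) + (-b) • (a • τ) := by
    have e : a • (τ * τ) = -(b • τ) - c • (1 : D) := by rw [← sub_eq_zero, ← hroot]; abel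
    rw [smul_mul_assoc, mul_smul_comm, smul_smul, mul_smul, e]
    module
  rw [this]
  exact zsmul_add_zsmul_mem_span_pair _ _ _ _

omit [Algebra ℚ D] [IsQuaternionAlgebra ℚ D] in
/-- **`[1, τ]_(q) = τ · ℤ[aτ]_(q)` when `aτ² + bτ + c = 0` with `q ∤ c`** (the local form of
Cox's Prop. 7.4 / Lemma 7.5: `[1, τ] = τ [1, -1/τ]` and `-c/τ = aτ + b`). [cite: Cox2013, §7.A Prop. 7.4, §7.B Lemma 7.5] -/
theorem localAt_span_pair_of_root (hD : ∀ x : D, x ≠ 0 → IsUnit x) {τ : D} (hτ0 : τ ≠ 0) {a b c : ℤ}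
    (hroot : a • (τ * τ) + b • τ + c • (1 : D) = 0) {q : ℕ} (hc0 : c ≠ 0) (hqc : c.natAbs.Coprime q) :
    localAt q (Submodule.span ℤ ({1, τ} : Set D)) =
      (hD τ hτ0).unit • localAt q (Submodule.span ℤ {1, a • τ}) := by
  set T : Dˣ := (hD τ hτ0).unit with hT
  have hTval : (T : D) = τ := (hD τ hτ0).unit_spec
  set w : D := ((T⁻¹ : Dˣ) : D) with hw
  have hτw : τ * w = 1 := by rw [← hTval, hw, Units.mul_inv]
  have hwτ : w * τ = 1 := by rw [← hTval, hw, Units.inv_mul]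
  -- `[1, τ] = τ [1, w]`
  have h1 : Submodule.span ℤ ({1, τ} : Set D) = T • Submodule.span ℤ ({1, w} : Set D) := by
    rw [units_smul_span_pair, hTval, mul_one, hτw, Set.pair_comm]
  -- `-c w = aτ + b`
  have h2 : (-c) • w = a • τ + (b : D) := by
    have e := congrArg (· * w) hroot
    simp only [add_mul, smul_mul_assoc, mul_assoc, hτw, mul_one, one_mul, zero_mul] at e
    rw [neg_smul, ← zsmul_one b, neg_eq_iff_eq_neg, eq_neg_iff_add_eq_zero, ← e]
    abel
  rw [h1, localAt_units_smul, localAt_span_one_zsmul (k := -c) (neg_ne_zero.mpr hc0) (by rwa [Int.natAbs_neg]) w,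
    h2, span_one_zsmul_add_int]

omit [IsQuaternionAlgebra ℚ D] [Algebra ℚ D] in
/-- The root equation of `τ + 1`: `a(τ+1)² + (b - 2a)(τ+1) + (a - b + c) = 0`. [folklore] -/
theorem root_add_one {τ : D} {a b c : ℤ} (hroot : a • (τ * τ) + b • τ + c • (1 : D) = 0) :
    a • ((τ + 1) * (τ + 1)) + (b - 2 * a) • (τ + 1) + (a - b + c) • (1 : D) = 0 := by
  rw [← hroot]
  simp only [add_mul, mul_add, mul_one, one_mul]
  module

/-- A prime cannot divide all three coefficients of a primitive form. [folklore] -/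
theorem not_dvd_of_isPrimitive {f : BinQF} (hf : f.IsPrimitive) {q : ℕ} (hq : q.Prime) :
    ¬ ((q : ℤ) ∣ f.a ∧ (q : ℤ) ∣ f.b ∧ (q : ℤ) ∣ f.c) := by
  rintro ⟨ha, hb, hc⟩
  have := (BinQF.isPrimitive_iff _).mp hf q ha hb hc
  rw [Int.isUnit_iff_natAbs_eq, Int.natAbs_natCast] at this
  exact hq.one_lt.ne' this

omit [IsQuaternionAlgebra ℚ D] [Algebra ℚ D] [Ring D] in
/-- `q ∤ k` gives `|k|` prime to `q`. [folklore] -/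
theorem natAbs_coprime_of_not_dvd {q : ℕ} (hq : q.Prime) {k : ℤ} (hk : ¬ (q : ℤ) ∣ k) : k.natAbs.Coprime q := by
  rw [Nat.coprime_comm, hq.coprime_iff_not_dvd]
  rwa [← Int.natCast_dvd_natCast, Int.dvd_natAbs] 

/-- **`[1, τ]` is locally principal for the order `ℤ[aτ]`** (`(a, b, c)` the primitive form of
`τ`): at `q ∤ a` it is `ℤ[aτ]_(q)`, at `q ∣ a, q ∤ c` it is `τ ℤ[aτ]_(q)`, and at `q ∣ a, q ∣ c`
(so `q ∤ b`) it is `(τ+1) ℤ[aτ]_(q)` — Cox's Prop. 7.4 (`[1, τ]` is a proper, hence invertible,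
ideal of `ℤ[aτ]`, Lemma 7.5) prime by prime. [cite: Cox2013, §7.A Prop. 7.4, §7.B Lemma 7.5] -/
theorem isLocPrin_span_pair (hD : ∀ x : D, x ≠ 0 → IsUnit x) (hτK : τ ∈ Algebra.adjoin ℚ {γ})
    (hτ : τ ∉ (⊥ : Subalgebra ℚ D)) :
    IsLocPrin γ (Submodule.span ℤ {1, (primForm τ).a • τ}) (Submodule.span ℤ {1, τ}) := by
  haveI : Nontrivial D := nontrivial_of_isQuaternionAlgebra
  intro q hq
  set f := primForm τ with hf
  have hroot : f.a • (τ * τ) + f.b • τ + f.c • (1 : D) = 0 := isRootOf_iff_zsmul.mp (isRootOf_primForm hτ)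
  have hprim := not_dvd_of_isPrimitive (isPrimitive_primForm hτ) hq
  have hcommγ : ∀ {x : D}, x ∈ Algebra.adjoin ℚ {γ} → x * γ = γ * x := fun hx =>
    (Algebra.adjoin_singleton_comm (K := ℚ) γ _ (Algebra.self_mem_adjoin_singleton ℚ γ) _ hx).symm
  have hτ0 : τ ≠ 0 := fun h => hτ (h ▸ Subalgebra.zero_mem _)
  by_cases hqa : (q : ℤ) ∣ f.a
  · by_cases hqc : (q : ℤ) ∣ f.c
    · -- `q ∣ a`, `q ∣ c`, so `q ∤ b`: use `τ + 1`
      have hqb : ¬ (q : ℤ) ∣ f.b := fun h => hprim ⟨hqa, h, hqc⟩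
      have hτ1K : τ + 1 ∈ Algebra.adjoin ℚ {γ} := Subalgebra.add_mem _ hτK (Subalgebra.one_mem _)
      have hτ10 : τ + 1 ≠ 0 := fun h => by
        apply hτ
        have : τ = -1 := eq_neg_of_add_eq_zero_left h
        rw [this]; exact Subalgebra.neg_mem _ (Subalgebra.one_mem _)
      have hc' : f.a - f.b + f.c ≠ 0 := fun h => hqb (by
        have : f.b = f.a + f.c := by linarith
        rw [this]; exact dvd_add hqa hqc)
      have hqc' : ¬ (q : ℤ) ∣ f.a - f.b + f.c := fun h => hqb (by
        have : f.b = f.a + f.c - (f.a - f.b + f.c) := by ring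
        rw [this]; exact dvd_sub (dvd_add hqa hqc) h)
      refine ⟨(hD _ hτ10).unit, by rw [(hD _ hτ10).unit_spec]; exact hcommγ hτ1K, ?_⟩
      have e := localAt_span_pair_of_root hD hτ10 (root_add_one hroot) (q := q) hc' (natAbs_coprime_of_not_dvd hq hqc')
      have h3 : Submodule.span ℤ ({1, τ + 1} : Set D) = Submodule.span ℤ {1, τ} := by
        have := span_one_add_int τ 1
        rwa [Int.cast_one] at this
      have h4 : Submodule.span ℤ ({1, f.a • (τ + 1)} : Set D) = Submodule.span ℤ {1, f.a • τ} := by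
        rw [smul_add, zsmul_one]
        exact span_one_zsmul_add_int τ f.a f.a
      rwa [h3, h4] at e
    · refine ⟨(hD τ hτ0).unit, by rw [(hD τ hτ0).unit_spec]; exact hcommγ hτK, ?_⟩
      exact localAt_span_pair_of_root hD hτ0 hroot (fun h => hqc (by rw [h]; exact dvd_zero _))
        (natAbs_coprime_of_not_dvd hq hqc)
  · refine ⟨1, by simp, ?_⟩
    rw [one_smul]
    exact localAt_span_one_zsmul (fun h => hqa (by rw [h]; exact dvd_zero _)) (natAbs_coprime_of_not_dvd hq hqa) τ

omit [IsQuaternionAlgebra ℚ D] [Algebra ℚ D] in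
/-- **Two rings which are translates of each other coincide**: if `X = uY` for `ℤ`-lattices
`X, Y` both containing `1` and closed under products, then `X = Y`. [folklore] -/
theorem eq_of_eq_units_smul_of_one_mem {X Y : Submodule ℤ D} {u : Dˣ} (hX1 : (1 : D) ∈ X)
    (hXmul : ∀ a ∈ X, ∀ b ∈ X, a * b ∈ X) (hY1 : (1 : D) ∈ Y) (hYmul : ∀ a ∈ Y, ∀ b ∈ Y, a * b ∈ Y)
    (h : X = u • Y) : X = Y := by
  have huinv : ((u⁻¹ : Dˣ) : D) ∈ Y := by
    have : (1 : D) ∈ u • Y := h ▸ hX1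
    rw [mem_units_smul_submodule_iff, Units.smul_def, smul_eq_mul, mul_one] at this
    exact this
  have hu : (u : D) ∈ X := by
    rw [h, mem_units_smul_submodule_iff, Units.smul_def, smul_eq_mul, Units.inv_mul]
    exact hY1
  apply le_antisymm
  · intro x hx
    rw [h, mem_units_smul_submodule_iff] at hx
    -- for `y ∈ Y`, `u y ∈ Y` because `(u)(u y) ∈ X X ⊆ X = u Y`
    have key : ∀ y ∈ Y, (u : D) * y ∈ Y := fun y hy => by
      have h1 : (u : D) * y ∈ X := by
        rw [h, mem_units_smul_submodule_iff, Units.smul_def, smul_eq_mul, ← mul_assoc, Units.inv_mul, one_mul]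
        exact hy
      have h2 := hXmul _ hu _ h1
      rw [h, mem_units_smul_submodule_iff, Units.smul_def, smul_eq_mul, ← mul_assoc, ← mul_assoc,
        Units.inv_mul, one_mul] at h2
      exact h2
    have := key _ hx
    rwa [Units.smul_def, smul_eq_mul, ← mul_assoc, Units.mul_inv, one_mul] at this
  · intro y hy
    rw [h, mem_units_smul_submodule_iff, Units.smul_def, smul_eq_mul]
    exact hYmul _ huinv _ hy

omit [IsQuaternionAlgebra ℚ D] in
/-- `γ` commutes with the elements of `ℚ(γ)`. [folklore] -/
theorem comm_of_mem_adjoin {x : D} (hx : x ∈ Algebra.adjoin ℚ {γ}) : x * γ = γ * x :=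
  (Algebra.adjoin_singleton_comm (K := ℚ) γ _ (Algebra.self_mem_adjoin_singleton ℚ γ) _ hx).symm

/-- **`[1, τ]` is locally `B`-principal iff `B = ℤ[aτ]`** (`a` the leading coefficient of the
primitive form of `τ`), for an order `B` of `ℚ(γ)`. [cite: Cox2013, §7.A Prop. 7.4 with §7.B Lemma 7.5] -/
theorem isLocPrin_iff_eq_span (hD : ∀ x : D, x ≠ 0 → IsUnit x) (hB : IsQuadOrder γ B)
    (hτK : τ ∈ Algebra.adjoin ℚ {γ}) (hτ : τ ∉ (⊥ : Subalgebra ℚ D)) :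
    IsLocPrin γ B (Submodule.span ℤ {1, τ}) ↔ B = Submodule.span ℤ {1, (primForm τ).a • τ} := by
  constructor
  · intro h
    set B₀ : Submodule ℤ D := Submodule.span ℤ {1, (primForm τ).a • τ} with hB₀
    have hB₀mul : ∀ x ∈ B₀, ∀ y ∈ B₀, x * y ∈ B₀ :=
      mul_mem_span_pair_of_sq_mem (sq_mem_span_pair_of_root (isRootOf_iff_zsmul.mp (isRootOf_primForm hτ)))
    refine eq_iff_forall_prime_localAt_eq.mpr fun q hq => ?_
    obtain ⟨x, -, hx⟩ := h q hq
    obtain ⟨y, -, hy⟩ := isLocPrin_span_pair hD hτK hτ q hq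
    have e : localAt q B = (x⁻¹ * y) • localAt q B₀ := by
      rw [mul_smul, ← hy, hx, smul_smul, inv_mul_cancel, one_smul]
    exact eq_of_eq_units_smul_of_one_mem (le_localAt q B hB.one_mem) (hB.localAt_mul_mem q)
      (le_localAt q B₀ (one_mem_span_pair _)) (fun a ha b hb => mul_mem_localAt hB₀mul q ha hb) e
  · intro h
    rw [h]
    exact isLocPrin_span_pair hD hτK hτ

/-! ### Discriminants of monogenic presentations -/

/-- The discriminant `trd(θ)² - 4 nrd(θ)` of the order `[1, θ]` does not depend on the generator:
`[1, θ] = [1, θ']` forces `θ' = ±θ + k`. [cite: Cox2013, §7.A (discriminant of an order, (7.2)–(7.3))] -/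
theorem disc_eq_of_span_eq (hD : ∀ x : D, x ≠ 0 → IsUnit x) (hγ : γ ∉ (⊥ : Subalgebra ℚ D))
    (himag : reducedTrace ℚ D γ ^ 2 < 4 * reducedNorm ℚ D γ) {θ θ' : D} (hθ'K : θ' ∈ Algebra.adjoin ℚ {γ}) (hθ' : θ' ∉ (⊥ : Subalgebra ℚ D))
    (h : Submodule.span ℤ ({1, θ} : Set D) = Submodule.span ℤ {1, θ'}) :
    reducedTrace ℚ D θ ^ 2 - 4 * reducedNorm ℚ D θ = reducedTrace ℚ D θ' ^ 2 - 4 * reducedNorm ℚ D θ' := by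
  haveI : Nontrivial D := nontrivial_of_isQuaternionAlgebra
  -- `θ' = u + vθ`, `θ = u' + v'θ'`
  have h1 : θ' ∈ Submodule.span ℤ ({1, θ} : Set D) := h ▸ right_mem_span_pair θ'
  have h2 : θ ∈ Submodule.span ℤ ({1, θ'} : Set D) := h.symm ▸ right_mem_span_pair θ
  obtain ⟨u, v, huv⟩ := Submodule.mem_span_pair.mp h1
  obtain ⟨u', v', huv'⟩ := Submodule.mem_span_pair.mp h2
  have eθ' : θ' = algebraMap ℚ D (u : ℚ) + (v : ℚ) • θ := by
    rw [← huv, map_intCast, Int.cast_smul_eq_zsmul, ← zsmul_one]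
  have eθ : θ = algebraMap ℚ D (u' : ℚ) + (v' : ℚ) • θ' := by
    rw [← huv', map_intCast, Int.cast_smul_eq_zsmul, ← zsmul_one]
  have d1 := disc_ratCoords (γ := θ) (u : ℚ) (v : ℚ)
  have d2 := disc_ratCoords (γ := θ') (u' : ℚ) (v' : ℚ)
  rw [← eθ'] at d1
  rw [← eθ] at d2
  -- the discriminants are non-zero (negative)
  have hneg : reducedTrace ℚ D θ' ^ 2 - 4 * reducedNorm ℚ D θ' < 0 := by
    obtain ⟨r, s, rfl⟩ := exists_rat_eq_of_mem_adjoin hD hγ hθ'K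
    rw [disc_ratCoords]
    have hs : s ≠ 0 := fun hs => hθ' (by
      rw [mem_bot_iff_qIm_eq_zero hD hγ hθ'K, qIm_ratCoords, hs])
    have : 0 < s ^ 2 := by positivity
    nlinarith
  have hvv : ((v : ℚ) * v') ^ 2 = 1 := by
    have e : ((v : ℚ) * v') ^ 2 * (reducedTrace ℚ D θ' ^ 2 - 4 * reducedNorm ℚ D θ') =
        reducedTrace ℚ D θ' ^ 2 - 4 * reducedNorm ℚ D θ' := by
      conv_rhs => rw [d1, d2]
      ring
    have hne : reducedTrace ℚ D θ' ^ 2 - 4 * reducedNorm ℚ D θ' ≠ 0 := hneg.ne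
    calc ((v : ℚ) * v') ^ 2 = ((v : ℚ) * v') ^ 2 * (reducedTrace ℚ D θ' ^ 2 - 4 * reducedNorm ℚ D θ') /
          (reducedTrace ℚ D θ' ^ 2 - 4 * reducedNorm ℚ D θ') := by rw [mul_div_cancel_right₀ _ hne]
      _ = 1 := by rw [e, div_self hne]
  have hv2 : (v : ℚ) ^ 2 = 1 := by
    have hi : v ^ 2 * v' ^ 2 = 1 := by
      have : ((v ^ 2 * v' ^ 2 : ℤ) : ℚ) = 1 := by push_cast; rw [← hvv]; ring
      exact_mod_cast this
    have hv2Z : v ^ 2 = 1 := Int.eq_one_of_mul_eq_one_right (sq_nonneg v) hi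
    exact_mod_cast hv2Z
  rw [d1, hv2, one_mul]

/-- **`trd σ = t` and `nrd σ = n`** for `σ = r₀ + γ/m` with `σ² = tσ - n`. [folklore] -/
theorem trd_nrd_of_sq (hγ : γ ∉ (⊥ : Subalgebra ℚ D)) {σ : D} {r₀ : ℚ} {m : ℕ} (hm : m ≠ 0)
    (hσ : σ = algebraMap ℚ D r₀ + (m : ℚ)⁻¹ • γ) {t n : ℤ} (hsq : σ * σ = (t : ℚ) • σ - algebraMap ℚ D n) :
    reducedTrace ℚ D σ = t ∧ reducedNorm ℚ D σ = n := by
  have hmQ : (m : ℚ) ≠ 0 := Nat.cast_ne_zero.mpr hm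
  have e : ∀ c d : ℚ, c • σ - algebraMap ℚ D d = algebraMap ℚ D (c * r₀ - d) + (c * (m : ℚ)⁻¹) • γ := by
    intro c d
    rw [hσ, smul_add, smul_smul, map_sub, map_mul, Algebra.smul_def c (algebraMap ℚ D r₀)]
    abel
  have h1 := mul_self_eq_reducedTrace_mul_sub_reducedNorm ℚ D σ
  rw [hsq, ← Algebra.smul_def, e, e] at h1
  obtain ⟨h2, h3⟩ := rat_coords_unique hγ h1
  have ht : reducedTrace ℚ D σ = t := (mul_right_cancel₀ (inv_ne_zero hmQ) h3).symm
  refine ⟨ht, ?_⟩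
  rw [ht] at h2
  linarith

/-- `trd(aτ)² - 4 nrd(aτ) = disc (primForm τ)`. [cite: Cox2013, §7.B Lemma 7.5 / Exercise 7.9] -/
theorem disc_zsmul_primForm_a (hτ : τ ∉ (⊥ : Subalgebra ℚ D)) :
    reducedTrace ℚ D ((primForm τ).a • τ) ^ 2 - 4 * reducedNorm ℚ D ((primForm τ).a • τ) = (primForm τ).disc := by
  rw [disc_primForm hτ, ← Int.cast_smul_eq_zsmul ℚ, map_smul, reducedNorm_smul, smul_eq_mul]
  ring

/-! ### Möbius transforms and homothety of `[1, τ]` -/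

omit [IsQuaternionAlgebra ℚ D] in
/-- Linear independence of `1, τ` over `ℤ` for `τ ∉ ℚ`. [folklore] -/
theorem zsmul_one_add_zsmul_eq_zero_iff [Nontrivial D] (hτ : τ ∉ (⊥ : Subalgebra ℚ D)) {u v : ℤ} :
    u • (1 : D) + v • τ = 0 ↔ u = 0 ∧ v = 0 := by
  have h := smul_one_add_smul_eq_zero_iff hτ (u := (u : ℚ)) (v := (v : ℚ))
  rw [map_intCast, Int.cast_smul_eq_zsmul, ← zsmul_one] at h
  rw [h]
  simp

/-- `moeb τ p q r s ∈ ℚ(γ)`. [folklore] -/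
theorem moeb_mem_adjoin (hD : ∀ x : D, x ≠ 0 → IsUnit x) (hτK : τ ∈ Algebra.adjoin ℚ {γ})
    (hτ : τ ∉ (⊥ : Subalgebra ℚ D)) (p q : ℤ) {r s : ℤ} (hrs : r ≠ 0 ∨ s ≠ 0) :
    moeb τ p q r s ∈ Algebra.adjoin ℚ {γ} := by
  haveI : Nontrivial D := nontrivial_of_isQuaternionAlgebra
  have hzK : (r : D) * τ + (s : D) ∈ Algebra.adjoin ℚ {γ} :=
    Subalgebra.add_mem _ (Subalgebra.mul_mem _ (Subalgebra.intCast_mem _ r) hτK) (Subalgebra.intCast_mem _ s)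
  refine Subalgebra.mul_mem _ (Subalgebra.add_mem _ (Subalgebra.mul_mem _ (Subalgebra.intCast_mem _ p) hτK)
    (Subalgebra.intCast_mem _ q)) ?_
  have hu := hD _ (linear_ne_zero hτ hrs)
  rw [Ring.inverse_of_isUnit hu]
  exact inv_mem_adjoin_singleton hD γ (x := hu.unit) hzK

/-- `moeb τ p q r s ∉ ℚ` when `ps - qr ≠ 0`. [folklore] -/
theorem moeb_not_mem_bot (hD : ∀ x : D, x ≠ 0 → IsUnit x) (hγ : γ ∉ (⊥ : Subalgebra ℚ D))
    (himag : reducedTrace ℚ D γ ^ 2 < 4 * reducedNorm ℚ D γ) (hτK : τ ∈ Algebra.adjoin ℚ {γ})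
    (hτ : τ ∉ (⊥ : Subalgebra ℚ D)) {p q r s : ℤ} (hdet : p * s - q * r ≠ 0) :
    moeb τ p q r s ∉ (⊥ : Subalgebra ℚ D) := by
  have hrs : r ≠ 0 ∨ s ≠ 0 := by
    by_contra h; push Not at h; obtain ⟨rfl, rfl⟩ := h; simp at hdet
  obtain ⟨hsign, hNpos⟩ := qIm_moeb hD hγ himag hτK hτ (p := p) (q := q) hrs
  have h0 : qIm hD hγ τ ≠ 0 := fun e => hτ ((mem_bot_iff_qIm_eq_zero hD hγ hτK).mpr e)
  rw [mem_bot_iff_qIm_eq_zero hD hγ (moeb_mem_adjoin hD hτK hτ p q hrs)]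
  intro e
  rw [e, zero_mul] at hsign
  have hdetQ : ((p * s - q * r : ℤ) : ℚ) ≠ 0 := by exact_mod_cast hdet
  push_cast at hdetQ
  exact mul_ne_zero hdetQ h0 hsign.symm

/-- **Möbius transforms are homotheties of `[1, τ]`**: `[1, (pτ+q)/(rτ+s)] = (rτ+s)⁻¹ [1, τ]` for
`ps - qr = ±1`. [cite: Cox2013, §7.B (proof of Thm. 7.7: "[1, τ'] = (rτ + s)⁻¹ [1, τ]")] -/
theorem span_pair_moeb (hD : ∀ x : D, x ≠ 0 → IsUnit x) (hτ : τ ∉ (⊥ : Subalgebra ℚ D))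
    {p q r s : ℤ} (hdet : p * s - q * r = 1 ∨ p * s - q * r = -1) :
    ∃ (hz : IsUnit ((r : D) * τ + (s : D))),
      Submodule.span ℤ ({1, moeb τ p q r s} : Set D) = (hz.unit⁻¹ : Dˣ) • Submodule.span ℤ {1, τ} := by
  haveI : Nontrivial D := nontrivial_of_isQuaternionAlgebra
  have hrs : r ≠ 0 ∨ s ≠ 0 := by
    by_contra h; push Not at h; obtain ⟨rfl, rfl⟩ := h
    rcases hdet with h | h <;> simp at h
  have hzu : IsUnit ((r : D) * τ + (s : D)) := hD _ (linear_ne_zero hτ hrs)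
  refine ⟨hzu, ?_⟩
  have hw : Ring.inverse ((r : D) * τ + (s : D)) = ((hzu.unit⁻¹ : Dˣ) : D) := Ring.inverse_of_isUnit hzu
  have e1 : ((hzu.unit⁻¹ : Dˣ) : D) * ((r : D) * τ + (s : D)) = 1 := by
    rw [← hw]; exact Ring.inverse_mul_cancel _ hzu
  have e2 : ((hzu.unit⁻¹ : Dˣ) : D) * ((p : D) * τ + (q : D)) = moeb τ p q r s := by
    rw [← hw]; exact (comm_ringInverse hzu (linear_comm τ p q r s)).symm
  rw [← span_pair_unimodular τ hdet, units_smul_span_pair, ← linear_eq_zsmul, ← linear_eq_zsmul]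
  simp only [e1, e2]

/-- **Homothetic `[1, τ']`, `[1, τ]` differ by a Möbius transform in `GL₂(ℤ)`**: if
`[1, τ'] = c [1, τ]` with `c ∈ ℚ(γ)ˣ` then `τ' = (pτ + q)/(rτ + s)` with `ps - qr = ±1`. [cite: Cox2013, §7.B (proof of Thm. 7.7: "τ' = (pτ+q)/(rτ+s) … in GL(2, ℤ)")] -/
theorem exists_moeb_of_span_eq_smul (hD : ∀ x : D, x ≠ 0 → IsUnit x) (hγ : γ ∉ (⊥ : Subalgebra ℚ D))
    {τ τ' : D} (hτ : τ ∉ (⊥ : Subalgebra ℚ D))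
    (hτ'K : τ' ∈ Algebra.adjoin ℚ {γ}) {c : Dˣ} (hc : (c : D) * γ = γ * c)
    (h : Submodule.span ℤ ({1, τ'} : Set D) = c • Submodule.span ℤ {1, τ}) :
    ∃ p q r s : ℤ, (p * s - q * r = 1 ∨ p * s - q * r = -1) ∧ τ' = moeb τ p q r s := by
  haveI : Nontrivial D := nontrivial_of_isQuaternionAlgebra
  have hcK : (c : D) ∈ Algebra.adjoin ℚ {γ} := mem_adjoin_of_comm hD hγ hc
  have hcommK : ∀ {x y : D}, x ∈ Algebra.adjoin ℚ {γ} → y ∈ Algebra.adjoin ℚ {γ} → x * y = y * x :=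
    fun hx hy => Algebra.adjoin_singleton_comm (K := ℚ) γ _ hx _ hy
  -- `c⁻¹ = s + rτ`, `c⁻¹ τ' = q + pτ`
  have h1 : ((c⁻¹ : Dˣ) : D) ∈ Submodule.span ℤ ({1, τ} : Set D) := by
    have : (1 : D) ∈ c • Submodule.span ℤ ({1, τ} : Set D) := h ▸ one_mem_span_pair τ'
    rwa [mem_units_smul_submodule_iff, Units.smul_def, smul_eq_mul, mul_one] at this
  have h2 : ((c⁻¹ : Dˣ) : D) * τ' ∈ Submodule.span ℤ ({1, τ} : Set D) := by
    have : τ' ∈ c • Submodule.span ℤ ({1, τ} : Set D) := h ▸ right_mem_span_pair τ'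
    rwa [mem_units_smul_submodule_iff, Units.smul_def, smul_eq_mul] at this
  obtain ⟨s, r, hsr⟩ := Submodule.mem_span_pair.mp h1
  obtain ⟨q, p, hqp⟩ := Submodule.mem_span_pair.mp h2
  -- `c = α + βτ'`, `cτ = α' + β'τ'`
  have h3 : (c : D) ∈ Submodule.span ℤ ({1, τ'} : Set D) := by
    rw [h, mem_units_smul_submodule_iff, Units.smul_def, smul_eq_mul, Units.inv_mul]
    exact one_mem_span_pair τ
  have h4 : (c : D) * τ ∈ Submodule.span ℤ ({1, τ'} : Set D) := by
    rw [h, mem_units_smul_submodule_iff, Units.smul_def, smul_eq_mul, ← mul_assoc, Units.inv_mul, one_mul]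
    exact right_mem_span_pair τ
  obtain ⟨α, β, hαβ⟩ := Submodule.mem_span_pair.mp h3
  obtain ⟨α', β', hαβ'⟩ := Submodule.mem_span_pair.mp h4
  -- the integer relations
  have hz : (r : D) * τ + (s : D) = ((c⁻¹ : Dˣ) : D) := by rw [linear_eq_zsmul, add_comm, hsr]
  have hy : (p : D) * τ + (q : D) = ((c⁻¹ : Dˣ) : D) * τ' := by rw [linear_eq_zsmul, add_comm, hqp]
  have e1 : (α * s + β * q - 1) • (1 : D) + (α * r + β * p) • τ = 0 := by
    -- multiply `c = α + βτ'` by `c⁻¹` on the left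
    have e : ((c⁻¹ : Dˣ) : D) * (α • (1 : D) + β • τ') = 1 := by rw [hαβ, Units.inv_mul]
    rw [mul_add, mul_smul_comm, mul_smul_comm, mul_one, ← hqp, ← hsr] at e
    rw [← sub_eq_zero] at e
    rw [← e]
    module
  have e2 : (α' * s + β' * q) • (1 : D) + (α' * r + β' * p - 1) • τ = 0 := by
    have e : ((c⁻¹ : Dˣ) : D) * (α' • (1 : D) + β' • τ') = τ := by
      rw [hαβ', ← mul_assoc, Units.inv_mul, one_mul]
    rw [mul_add, mul_smul_comm, mul_smul_comm, mul_one, ← hqp, ← hsr] at e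
    rw [← sub_eq_zero] at e
    rw [← e]
    module
  obtain ⟨f1, f2⟩ := (zsmul_one_add_zsmul_eq_zero_iff hτ).mp e1
  obtain ⟨f3, f4⟩ := (zsmul_one_add_zsmul_eq_zero_iff hτ).mp e2
  have hdet' : (α * β' - β * α') * (p * s - q * r) = 1 := by
    linear_combination (α' * r + β' * p) * f1 + f4 - (α' * s + β' * q) * f2
  refine ⟨p, q, r, s, ?_, ?_⟩
  · rcases Int.eq_one_or_neg_one_of_mul_eq_one' hdet' with ⟨-, h⟩ | ⟨-, h⟩
    · exact Or.inl h
    · exact Or.inr h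
  · rw [moeb, hz, hy, Ring.inverse_unit, inv_inv, mul_assoc, hcommK hτ'K hcK, ← mul_assoc, Units.inv_mul, one_mul]

/-! ### `[1, τ]` is a lattice of `ℚ(γ)` -/

/-- `[1, τ] ⊆ ℚ(γ)` is a full lattice for `τ ∈ ℚ(γ) ∖ ℚ`. [cite: Cox2013, §7.A] -/
theorem isKLattice_span_pair (hD : ∀ x : D, x ≠ 0 → IsUnit x) (hγ : γ ∉ (⊥ : Subalgebra ℚ D))
    (hτK : τ ∈ Algebra.adjoin ℚ {γ}) (hτ : τ ∉ (⊥ : Subalgebra ℚ D)) :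
    IsKLattice γ (Submodule.span ℤ {1, τ}) := by
  haveI : Nontrivial D := nontrivial_of_isQuaternionAlgebra
  refine ⟨Submodule.fg_span (Set.toFinite _), ?_, fun z hz => ?_⟩
  · rw [Submodule.span_le]
    rintro x (rfl | rfl)
    · exact Subalgebra.one_mem _
    · exact hτK
  · obtain ⟨α, β, hτe⟩ := exists_rat_eq_of_mem_adjoin hD hγ hτK
    have hβ : β ≠ 0 := fun hβ => hτ (by
      rw [mem_bot_iff_qIm_eq_zero hD hγ hτK, hτe, qIm_ratCoords, hβ])
    obtain ⟨u, v, rfl⟩ := exists_rat_eq_of_mem_adjoin hD hγ hz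
    -- `γ = β⁻¹ (τ - α)`, so `z = (u - vα/β) + (v/β) τ`
    set u' : ℚ := u - v * α / β with hu'
    set v' : ℚ := v / β with hv'
    have e1 : u' + v' * α = u := by rw [hu', hv']; field_simp; ring
    have e2 : v' * β = v := by rw [hv']; exact div_mul_cancel₀ v hβ
    have hz' : algebraMap ℚ D u + v • γ = algebraMap ℚ D u' + v' • τ := by
      conv_lhs => rw [← e1, ← e2]
      rw [hτe, smul_add, smul_smul, map_add, Algebra.smul_def v' (algebraMap ℚ D α), ← map_mul]
      abel
    -- clear denominators
    refine ⟨(u'.den : ℤ) * v'.den, mul_ne_zero (by exact_mod_cast u'.den_nz) (by exact_mod_cast v'.den_nz), ?_⟩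
    rw [hz']
    have ku : ((u'.den : ℤ) * v'.den : ℤ) • algebraMap ℚ D u' = ((v'.den : ℤ) * u'.num) • (1 : D) := by
      rw [← Int.cast_smul_eq_zsmul ℚ, ← Int.cast_smul_eq_zsmul ℚ, Algebra.algebraMap_eq_smul_one, smul_smul]
      congr 1
      push_cast
      have := Rat.mul_den_eq_num u'
      linear_combination (v'.den : ℚ) * this
    have kv : ((u'.den : ℤ) * v'.den : ℤ) • (v' • τ) = ((u'.den : ℤ) * v'.num) • τ := by
      rw [← Int.cast_smul_eq_zsmul ℚ, ← Int.cast_smul_eq_zsmul ℚ, smul_smul]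
      congr 1
      push_cast
      have := Rat.mul_den_eq_num v'
      linear_combination (u'.den : ℚ) * this
    rw [smul_add, ku, kv]
    exact zsmul_add_zsmul_mem_span_pair _ _ _ _

/-! ### The setting -/

/-- **Hypotheses of the class number identity**, bundled: `D` is a division algebra, `γ ∉ ℚ` with
`trd(γ)² < 4 nrd(γ)` (so `ℚ(γ)` is imaginary quadratic), and `B ∋ γ` is an order of `ℚ(γ)` with
`ℤ`-basis `(1, σ)`, `σ = r₀ + γ/m`, `σ² = tσ - n` (discriminant `t² - 4n`). [cite: Cox2013, §7.A (7.2), §7.B Thm. 7.7] -/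
structure PicHyp (γ : D) (B : Submodule ℤ D) (σ : D) (r₀ : ℚ) (m : ℕ) (t n : ℤ) : Prop where
  hdiv : ∀ x : D, x ≠ 0 → IsUnit x
  hγ : γ ∉ (⊥ : Subalgebra ℚ D)
  himag : reducedTrace ℚ D γ ^ 2 < 4 * reducedNorm ℚ D γ
  hB : IsQuadOrder γ B
  hm : m ≠ 0
  hσ : σ = algebraMap ℚ D r₀ + (m : ℚ)⁻¹ • γ
  hBσ : ∀ b : D, b ∈ B ↔ ∃ u v : ℤ, b = algebraMap ℚ D u + v • σ
  hsq : σ * σ = (t : ℚ) • σ - algebraMap ℚ D n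

namespace PicHyp

variable {σ : D} {r₀ : ℚ} {m : ℕ} {t n : ℤ} (H : PicHyp γ B σ r₀ m t n)
include H

omit [IsQuaternionAlgebra ℚ D] in
/-- `B = [1, σ]`. [folklore] -/
theorem eq_span : B = Submodule.span ℤ {1, σ} := by
  ext b
  rw [H.hBσ, Submodule.mem_span_pair]
  constructor
  · rintro ⟨u, v, rfl⟩
    exact ⟨u, v, by rw [map_intCast, zsmul_one]⟩
  · rintro ⟨u, v, rfl⟩
    exact ⟨u, v, by rw [map_intCast, zsmul_one]⟩

omit [IsQuaternionAlgebra ℚ D] in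
/-- `σ ∈ ℚ(γ)`. [folklore] -/
theorem σ_mem_adjoin : σ ∈ Algebra.adjoin ℚ {γ} := by
  rw [H.hσ]; exact ratCoords_mem_adjoin γ _ _

/-- `qIm σ = 1/m`. [folklore] -/
theorem qIm_σ : qIm H.hdiv H.hγ σ = (m : ℚ)⁻¹ := by
  have := qIm_ratCoords H.hdiv H.hγ r₀ ((m : ℚ)⁻¹)
  rwa [← H.hσ] at this

/-- `σ ∉ ℚ`. [folklore] -/
theorem σ_not_mem_bot : σ ∉ (⊥ : Subalgebra ℚ D) := by
  rw [mem_bot_iff_qIm_eq_zero H.hdiv H.hγ H.σ_mem_adjoin, H.qIm_σ]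
  exact inv_ne_zero (Nat.cast_ne_zero.mpr H.hm)

/-- The discriminant `t² - 4n` of `B` is `trd(σ)² - 4 nrd(σ)`. [cite: Cox2013, §7.A (7.2)] -/
theorem disc_eq : ((t ^ 2 - 4 * n : ℤ) : ℚ) = reducedTrace ℚ D σ ^ 2 - 4 * reducedNorm ℚ D σ := by
  obtain ⟨h1, h2⟩ := trd_nrd_of_sq H.hγ H.hm H.hσ H.hsq
  rw [h1, h2]; push_cast; ring

/-- **`t² - 4n < 0`.** [cite: Cox2013, §7.A] -/
theorem disc_neg : t ^ 2 - 4 * n < 0 := by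
  have h := H.disc_eq
  rw [H.hσ, disc_ratCoords] at h
  have hm : (0 : ℚ) < ((m : ℚ)⁻¹) ^ 2 := by
    have : (m : ℚ) ≠ 0 := Nat.cast_ne_zero.mpr H.hm
    positivity
  have : ((t ^ 2 - 4 * n : ℤ) : ℚ) < 0 := by rw [h]; nlinarith [H.himag]
  exact_mod_cast this

/-! ### Every lattice of `ℚ(γ)` is `c [1, τ]` -/

/-- **Hermite normal form**: every lattice `L` of `ℚ(γ)` is `c [1, τ]` with `c ∈ ℚ(γ)ˣ` and
`τ ∈ ℚ(γ) ∖ ℚ` (scale `L` into `B = [1, σ]`, take `A ℤ = dL ∩ ℤ`, `g ℤ` the `σ`-coordinates of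
`dL` and `k + gσ ∈ dL`; then `dL = [A, k + gσ]`). [cite: Cox2013, §7.B (proof of Thm. 7.7: "𝔞 = [α, β] … τ = β/α"), Exercise 7.12] -/
theorem exists_eq_smul_span_pair {L : Submodule ℤ D} (hL : IsKLattice γ L) :
    ∃ c : Dˣ, (c : D) * γ = γ * c ∧ ∃ τ : D, τ ∈ Algebra.adjoin ℚ {γ} ∧ τ ∉ (⊥ : Subalgebra ℚ D) ∧
      L = c • Submodule.span ℤ {1, τ} := by
  haveI : Nontrivial D := nontrivial_of_isQuaternionAlgebra
  haveI : IsAddTorsionFree D := isAddTorsionFree_of_charZero_module ℚ D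
  obtain ⟨d, hd0, hd⟩ := IsQuadOrder.exists_nat_smul_mem_of_full H.hB.full hL.fg hL.le_adjoin
  have hdZ : (d : ℤ) ≠ 0 := by exact_mod_cast hd0
  have hdQ : (d : ℚ) ≠ 0 := by exact_mod_cast hd0
  -- coordinates of `d x` for `x ∈ L`
  have hcoord : ∀ x ∈ L, ∃ u v : ℤ, (d : ℤ) • x = algebraMap ℚ D u + v • σ := fun x hx =>
    (H.hBσ _).mp (hd x hx)
  -- the subgroups of `σ`-coordinates and of rational elements
  let V : AddSubgroup ℤ :=
    { carrier := {v | ∃ x ∈ L, ∃ u : ℤ, (d : ℤ) • x = algebraMap ℚ D u + v • σ}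
      zero_mem' := ⟨0, L.zero_mem, 0, by simp⟩
      add_mem' := by
        rintro a b ⟨x, hx, u, hxe⟩ ⟨y, hy, u', hye⟩
        refine ⟨x + y, L.add_mem hx hy, u + u', ?_⟩
        rw [smul_add, hxe, hye, Int.cast_add, map_add, add_smul]; abel
      neg_mem' := by
        rintro a ⟨x, hx, u, hxe⟩
        refine ⟨-x, L.neg_mem hx, -u, ?_⟩
        rw [smul_neg, hxe, Int.cast_neg, map_neg, neg_smul]; abel }
  let U : AddSubgroup ℤ :=
    { carrier := {u | ∃ x ∈ L, (d : ℤ) • x = algebraMap ℚ D u}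
      zero_mem' := ⟨0, L.zero_mem, by simp⟩
      add_mem' := by
        rintro a b ⟨x, hx, hxe⟩ ⟨y, hy, hye⟩
        refine ⟨x + y, L.add_mem hx hy, ?_⟩
        rw [smul_add, hxe, hye, Int.cast_add, map_add]
      neg_mem' := by
        rintro a ⟨x, hx, hxe⟩
        refine ⟨-x, L.neg_mem hx, ?_⟩
        rw [smul_neg, hxe, Int.cast_neg, map_neg] }
  obtain ⟨g, hg⟩ := Int.subgroup_cyclic V
  obtain ⟨A, hA⟩ := Int.subgroup_cyclic U
  have hgV : g ∈ V := hg ▸ AddSubgroup.subset_closure rfl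
  have hAU : A ∈ U := hA ▸ AddSubgroup.subset_closure rfl
  obtain ⟨xg, hxgL, k₀, hxg⟩ := hgV
  obtain ⟨xA, hxAL, hxA⟩ := hAU
  have hVmem : ∀ v ∈ V, ∃ j : ℤ, v = j * g := fun v hv => by
    rw [hg, AddSubgroup.mem_closure_singleton] at hv
    obtain ⟨j, hj⟩ := hv
    exact ⟨j, by rw [← hj, smul_eq_mul]⟩
  have hUmem : ∀ u ∈ U, ∃ j : ℤ, u = j * A := fun u hu => by
    rw [hA, AddSubgroup.mem_closure_singleton] at hu
    obtain ⟨j, hj⟩ := hu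
    exact ⟨j, by rw [← hj, smul_eq_mul]⟩
  -- `A ≠ 0` and `g ≠ 0` by fullness of `L`
  have hA0 : A ≠ 0 := by
    obtain ⟨k, hk0, hk⟩ := hL.full 1 (Subalgebra.one_mem _)
    have hmem : (d : ℤ) * k ∈ U := ⟨k • (1 : D), hk, by
      rw [smul_smul, map_intCast, ← zsmul_one]⟩
    obtain ⟨j, hj⟩ := hUmem _ hmem
    intro hA0
    rw [hA0, mul_zero] at hj
    exact mul_ne_zero hdZ hk0 hj
  have hg0 : g ≠ 0 := by
    obtain ⟨k, hk0, hk⟩ := hL.full σ H.σ_mem_adjoin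
    have hmem : (d : ℤ) * k ∈ V := ⟨k • σ, hk, 0, by rw [smul_smul]; simp⟩
    obtain ⟨j, hj⟩ := hVmem _ hmem
    intro hg0
    rw [hg0, mul_zero] at hj
    exact mul_ne_zero hdZ hk0 hj
  have hAQ : (A : ℚ) ≠ 0 := by exact_mod_cast hA0
  -- the representative
  set τ : D := algebraMap ℚ D ((k₀ : ℚ) / A) + ((g : ℚ) / A) • σ with hτ
  have hc0 : algebraMap ℚ D ((A : ℚ) / d) ≠ 0 := by
    rw [map_ne_zero_iff _ (algebraMap ℚ D).injective]; exact div_ne_zero hAQ hdQ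
  set c : Dˣ := (H.hdiv _ hc0).unit with hc
  have hcval : (c : D) = algebraMap ℚ D ((A : ℚ) / d) := (H.hdiv _ hc0).unit_spec
  have hc1 : (c : D) * 1 = xA := by
    rw [mul_one, hcval]
    have : (d : ℚ) • xA = algebraMap ℚ D A := by
      rw [show (d : ℚ) = ((d : ℤ) : ℚ) by simp, Int.cast_smul_eq_zsmul, hxA]
    rw [div_eq_inv_mul, map_mul, ← Algebra.smul_def, ← this, smul_smul, inv_mul_cancel₀ hdQ, one_smul]
  have hcτ : (c : D) * τ = xg := by
    rw [hcval, hτ]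
    have : (d : ℚ) • xg = algebraMap ℚ D k₀ + (g : ℚ) • σ := by
      rw [show (d : ℚ) = ((d : ℤ) : ℚ) by simp, Int.cast_smul_eq_zsmul, hxg, Int.cast_smul_eq_zsmul]
    have e : algebraMap ℚ D ((A : ℚ) / d) * (algebraMap ℚ D ((k₀ : ℚ) / A) + ((g : ℚ) / A) • σ) =
        (d : ℚ)⁻¹ • (algebraMap ℚ D k₀ + (g : ℚ) • σ) := by
      rw [mul_add, ← map_mul, mul_smul_comm, ← Algebra.smul_def, smul_smul, smul_add, smul_smul,
        Algebra.algebraMap_eq_smul_one, Algebra.algebraMap_eq_smul_one, smul_smul]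
      congr 2 <;> field_simp
    rw [e, ← this, smul_smul, inv_mul_cancel₀ hdQ, one_smul]
  refine ⟨c, by rw [hcval]; exact Algebra.commutes _ _, τ, ?_, ?_, ?_⟩
  · exact Subalgebra.add_mem _ (Subalgebra.algebraMap_mem _ _) (Subalgebra.smul_mem _ H.σ_mem_adjoin _)
  · have hτK : τ ∈ Algebra.adjoin ℚ {γ} :=
      Subalgebra.add_mem _ (Subalgebra.algebraMap_mem _ _) (Subalgebra.smul_mem _ H.σ_mem_adjoin _)
    rw [mem_bot_iff_qIm_eq_zero H.hdiv H.hγ hτK, hτ,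
      qIm_add H.hdiv H.hγ (Subalgebra.algebraMap_mem _ _) (Subalgebra.smul_mem _ H.σ_mem_adjoin _),
      qIm_algebraMap, qIm_smul H.hdiv H.hγ H.σ_mem_adjoin, H.qIm_σ, zero_add]
    have hgQ : (g : ℚ) ≠ 0 := by exact_mod_cast hg0
    exact mul_ne_zero (div_ne_zero hgQ hAQ) (inv_ne_zero (Nat.cast_ne_zero.mpr H.hm))
  · rw [units_smul_span_pair, hc1, hcτ]
    apply le_antisymm
    · intro x hx
      obtain ⟨u, v, hxe⟩ := hcoord x hx
      obtain ⟨j, hj⟩ := hVmem v ⟨x, hx, u, hxe⟩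
      have hjk : j • (algebraMap ℚ D (k₀ : ℚ) + g • σ) = algebraMap ℚ D ((j * k₀ : ℤ) : ℚ) + (j * g) • σ := by
        rw [smul_add, smul_smul, zsmul_eq_mul, ← map_intCast (algebraMap ℚ D) j, ← map_mul, ← Int.cast_mul]
      -- `x - j xg` is rational
      have h2 : (d : ℤ) • (x - j • xg) = algebraMap ℚ D ((u - j * k₀ : ℤ) : ℚ) := by
        rw [smul_sub, smul_comm, hxe, hxg, hj, hjk, Int.cast_sub, map_sub]
        abel
      obtain ⟨j', hj'⟩ := hUmem (u - j * k₀) ⟨x - j • xg, L.sub_mem hx (L.smul_mem _ hxgL), h2⟩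
      have hjA : j' • algebraMap ℚ D (A : ℚ) = algebraMap ℚ D ((j' * A : ℤ) : ℚ) := by
        rw [zsmul_eq_mul, ← map_intCast (algebraMap ℚ D) j', ← map_mul, ← Int.cast_mul]
      have hx' : (d : ℤ) • x = (d : ℤ) • (j' • xA + j • xg) := by
        rw [smul_add, smul_comm _ j', smul_comm _ j, hxA, hxg, hjk, hxe, hj, hjA, ← hj', Int.cast_sub, map_sub]
        abel
      have : x = j' • xA + j • xg := smul_right_injective D hdZ hx'
      rw [this]
      exact zsmul_add_zsmul_mem_span_pair _ _ _ _
    · rw [Submodule.span_le]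
      rintro z (rfl | rfl)
      · exact hxAL
      · exact hxgL

end PicHyp

/-! ### Classes of primitive positive definite forms -/

omit [Ring D] [Algebra ℚ D] [IsQuaternionAlgebra ℚ D] in
/-- Proper equivalence on the primitive positive definite forms of discriminant `Δ`. [cite: Cox2013, §2.A] -/
def formSetoid (Δ : ℤ) : Setoid {f : BinQF // f.IsPosPrim Δ} where
  r f g := f.1.ProperEquiv g.1
  iseqv := ⟨fun f => BinQF.ProperEquiv.refl f.1, fun h => h.symm, fun h h' => h.trans h'⟩

/-- **The form classes `C(Δ)`**: primitive positive definite forms of discriminant `Δ` modulo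
proper equivalence. [cite: Cox2013, §2.A, §3.A (C(D))] -/
def FormClass (Δ : ℤ) : Type := Quotient (formSetoid Δ)

/-- **`#C(Δ) = h(Δ)`**: the classes are represented exactly once by the reduced forms
(Cox Thm. 2.8), which `BinQF.classNumber` counts. [cite: Cox2013, §2.A Thm. 2.8, Thm. 2.13] -/
theorem card_formClass {Δ : ℤ} (hΔ : Δ < 0) : Nat.card (FormClass Δ) = BinQF.classNumber Δ := by
  classical
  set R := (BinQF.reducedFormsList Δ).toFinset with hRdef
  have hR : ∀ f, f ∈ R ↔ f.IsPosPrim Δ ∧ f.IsReduced := fun f => by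
    rw [hRdef, List.mem_toFinset, BinQF.mem_reducedFormsList_iff _ hΔ]
  let φ : R → FormClass Δ := fun f => Quotient.mk (formSetoid Δ) ⟨f.1, ((hR f.1).mp f.2).1⟩
  have hφ : Function.Bijective φ := by
    constructor
    · intro f g h
      have hf := (hR f.1).mp f.2
      have hg := (hR g.1).mp g.2
      exact Subtype.ext (BinQF.eq_of_properEquiv_of_isReduced hf.1 hg.1 hf.2 hg.2 (Quotient.exact h))
    · intro x
      induction x using Quotient.inductionOn with
      | h f =>
      obtain ⟨g, hfg, hgr⟩ := BinQF.exists_properEquiv_isReduced hΔ f.2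
      have hg : g.IsPosPrim Δ := hfg.isPosPrim hΔ f.2
      exact ⟨⟨g, (hR g).mpr ⟨hg, hgr⟩⟩, Quotient.sound hfg.symm⟩
  rw [← Nat.card_congr (Equiv.ofBijective φ hφ), Nat.card_eq_fintype_card, Fintype.card_coe,
    BinQF.classNumber_eq_card]

/-! ### Oriented forms of Möbius transforms, exactly -/

/-- `primForm ((pτ+q)/(rτ+s)) = (primForm τ)·(s, -q; -r, p)` for `ps - qr = 1`. [cite: Cox2013, §7.B (proof of Thm. 7.7)] -/
theorem primForm_moeb_of_det_one (hD : ∀ x : D, x ≠ 0 → IsUnit x) (hγ : γ ∉ (⊥ : Subalgebra ℚ D))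
    (himag : reducedTrace ℚ D γ ^ 2 < 4 * reducedNorm ℚ D γ) (hτK : τ ∈ Algebra.adjoin ℚ {γ})
    (hτ : τ ∉ (⊥ : Subalgebra ℚ D)) {p q r s : ℤ} (hdet : p * s - q * r = 1) :
    primForm (moeb τ p q r s) = (primForm τ).act s (-q) (-r) p := by
  have hrs : r ≠ 0 ∨ s ≠ 0 := by
    by_contra h; push Not at h; obtain ⟨rfl, rfl⟩ := h; simp at hdet
  have hτ'nb := moeb_not_mem_bot hD hγ himag hτK hτ (p := p) (q := q) (r := r) (s := s) (by rw [hdet]; exact one_ne_zero)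
  symm
  refine eq_primForm hτ'nb (isRootOf_moeb hD hτ (isRootOf_primForm hτ) hrs)
    ((isPrimitive_primForm hτ).act (by linear_combination hdet)) ?_
  rw [BinQF.a_act]
  exact BinQF.eval_pos _ (primForm_a_pos hτ) (disc_primForm_neg hD hγ himag hτK hτ) (by
    rcases hrs with h | h
    · exact Or.inr (neg_ne_zero.mpr h)
    · exact Or.inl h)

/-- Orientation is preserved by `SL₂(ℤ)`: `qIm τ' > 0 ↔ qIm τ > 0`. [cite: Cox2013, §7.B (proof of Thm. 7.7)] -/
theorem qIm_moeb_pos_iff (hD : ∀ x : D, x ≠ 0 → IsUnit x) (hγ : γ ∉ (⊥ : Subalgebra ℚ D))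
    (himag : reducedTrace ℚ D γ ^ 2 < 4 * reducedNorm ℚ D γ) (hτK : τ ∈ Algebra.adjoin ℚ {γ})
    (hτ : τ ∉ (⊥ : Subalgebra ℚ D)) {p q r s : ℤ} (hdet : p * s - q * r = 1) :
    0 < qIm hD hγ (moeb τ p q r s) ↔ 0 < qIm hD hγ τ := by
  have hrs : r ≠ 0 ∨ s ≠ 0 := by
    by_contra h; push Not at h; obtain ⟨rfl, rfl⟩ := h; simp at hdet
  obtain ⟨hsign, hNpos⟩ := qIm_moeb hD hγ himag hτK hτ (p := p) (q := q) hrs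
  have hdetQ : (p : ℚ) * s - q * r = 1 := by exact_mod_cast hdet
  rw [hdetQ, one_mul] at hsign
  constructor
  · intro h; rw [← hsign]; exact mul_pos h hNpos
  · intro h; rw [← hsign] at h; exact pos_of_mul_pos_left h hNpos.le

/-- **Every `SL₂(ℤ)`-translate of `oform τ` is the oriented form of a Möbius transform of `τ`.** [cite: Cox2013, §7.B (proof of Thm. 7.7, injectivity)] -/
theorem exists_moeb_oform_eq_act (hD : ∀ x : D, x ≠ 0 → IsUnit x) (hγ : γ ∉ (⊥ : Subalgebra ℚ D))
    (himag : reducedTrace ℚ D γ ^ 2 < 4 * reducedNorm ℚ D γ) (hτK : τ ∈ Algebra.adjoin ℚ {γ})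
    (hτ : τ ∉ (⊥ : Subalgebra ℚ D)) {p q r s : ℤ} (hdet : p * s - q * r = 1) :
    ∃ p' q' r' s' : ℤ, p' * s' - q' * r' = 1 ∧
      oform hD hγ (moeb τ p' q' r' s') = (oform hD hγ τ).act p q r s := by
  classical
  by_cases hpos : 0 < qIm hD hγ τ
  · refine ⟨s, -q, -r, p, by linear_combination hdet, ?_⟩
    have hdet' : s * p - (-q) * (-r) = 1 := by linear_combination hdet
    unfold oform
    rw [if_pos hpos, if_pos ((qIm_moeb_pos_iff hD hγ himag hτK hτ hdet').mpr hpos),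
      primForm_moeb_of_det_one hD hγ himag hτK hτ hdet']
    simp only [neg_neg]
  · refine ⟨s, q, r, p, by linear_combination hdet, ?_⟩
    have hdet' : s * p - q * r = 1 := by linear_combination hdet
    unfold oform
    rw [if_neg hpos, if_neg (fun h => hpos ((qIm_moeb_pos_iff hD hγ himag hτK hτ hdet').mp h)),
      primForm_moeb_of_det_one hD hγ himag hτK hτ hdet', flipB_act]

namespace PicHyp

variable {σ : D} {r₀ : ℚ} {m : ℕ} {t n : ℤ} (H : PicHyp γ B σ r₀ m t n)
include H

/-! ### The form class of a locally principal lattice -/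

/-- The chosen presentation `L = c [1, τ_L]` of a locally principal lattice: the element `τ_L`. [folklore] -/
def repτ (L : locPrinLattices γ B) : D :=
  (H.exists_eq_smul_span_pair L.2.1).choose_spec.2.choose

/-- The chosen presentation `L = c [1, τ_L]`: the unit `c`. [folklore] -/
def repc (L : locPrinLattices γ B) : Dˣ :=
  (H.exists_eq_smul_span_pair L.2.1).choose

/-- `c` commutes with `γ`. [folklore] -/
theorem repc_comm (L : locPrinLattices γ B) : (H.repc L : D) * γ = γ * H.repc L :=
  (H.exists_eq_smul_span_pair L.2.1).choose_spec.1

/-- `τ_L ∈ ℚ(γ)`. [folklore] -/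
theorem repτ_mem (L : locPrinLattices γ B) : H.repτ L ∈ Algebra.adjoin ℚ {γ} :=
  (H.exists_eq_smul_span_pair L.2.1).choose_spec.2.choose_spec.1

/-- `τ_L ∉ ℚ`. [folklore] -/
theorem repτ_not_mem_bot (L : locPrinLattices γ B) : H.repτ L ∉ (⊥ : Subalgebra ℚ D) :=
  (H.exists_eq_smul_span_pair L.2.1).choose_spec.2.choose_spec.2.1

/-- `L = c [1, τ_L]`. [folklore] -/
theorem eq_repc_smul (L : locPrinLattices γ B) :
    (L : Submodule ℤ D) = H.repc L • Submodule.span ℤ {1, H.repτ L} :=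
  (H.exists_eq_smul_span_pair L.2.1).choose_spec.2.choose_spec.2.2

/-- `[1, τ_L]` is locally `B`-principal. [folklore] -/
theorem isLocPrin_span_repτ (L : locPrinLattices γ B) : IsLocPrin γ B (Submodule.span ℤ {1, H.repτ L}) := by
  have h : Submodule.span ℤ ({1, H.repτ L} : Set D) = (H.repc L)⁻¹ • (L : Submodule ℤ D) := by
    rw [H.eq_repc_smul L, smul_smul, inv_mul_cancel, one_smul]
  rw [h]
  exact L.2.2.units_smul (units_inv_comm (H.repc_comm L))

/-- **The discriminant of the primitive form of `τ` is `t² - 4n` when `[1, τ]` is locally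
`B`-principal** (`B = ℤ[aτ]`). [cite: Cox2013, §7.B (proof of Thm. 7.7: "disc f = disc 𝒪")] -/
theorem disc_primForm_eq (hτK : τ ∈ Algebra.adjoin ℚ {γ}) (hτ : τ ∉ (⊥ : Subalgebra ℚ D))
    (hL : IsLocPrin γ B (Submodule.span ℤ {1, τ})) : (primForm τ).disc = t ^ 2 - 4 * n := by
  have hB : B = Submodule.span ℤ {1, (primForm τ).a • τ} := (isLocPrin_iff_eq_span H.hdiv H.hB hτK hτ).mp hL
  have haτK : (primForm τ).a • τ ∈ Algebra.adjoin ℚ {γ} := Subalgebra.zsmul_mem _ hτK _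
  have haτ : (primForm τ).a • τ ∉ (⊥ : Subalgebra ℚ D) := by
    rw [mem_bot_iff_qIm_eq_zero H.hdiv H.hγ haτK, ← Int.cast_smul_eq_zsmul ℚ, qIm_smul H.hdiv H.hγ hτK]
    have h0 : qIm H.hdiv H.hγ τ ≠ 0 := fun e => hτ ((mem_bot_iff_qIm_eq_zero H.hdiv H.hγ hτK).mpr e)
    exact mul_ne_zero (by exact_mod_cast (primForm_a_pos hτ).ne') h0
  have h := disc_eq_of_span_eq H.hdiv H.hγ H.himag haτK haτ (H.eq_span.symm.trans hB)
  rw [← H.disc_eq, disc_zsmul_primForm_a hτ] at h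
  exact_mod_cast h.symm

/-- The oriented form of `τ_L`, a primitive positive definite form of discriminant `t² - 4n`. [cite: Cox2013, §7.B (proof of Thm. 7.7)] -/
def formOf (L : locPrinLattices γ B) : {f : BinQF // f.IsPosPrim (t ^ 2 - 4 * n)} :=
  ⟨oform H.hdiv H.hγ (H.repτ L), by
    rw [← H.disc_primForm_eq (H.repτ_mem L) (H.repτ_not_mem_bot L) (H.isLocPrin_span_repτ L)]
    exact isPosPrim_oform H.hdiv H.hγ (H.repτ_not_mem_bot L)⟩

/-- **Two presentations `c [1, τ] = c' [1, τ']` give properly equivalent oriented forms.** [cite: Cox2013, §7.B (proof of Thm. 7.7, well-definedness)] -/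
theorem properEquiv_oform_of_smul_eq {τ τ' : D} (hτK : τ ∈ Algebra.adjoin ℚ {γ}) (hτ : τ ∉ (⊥ : Subalgebra ℚ D))
    (hτ'K : τ' ∈ Algebra.adjoin ℚ {γ}) {c c' : Dˣ} (hc : (c : D) * γ = γ * c) (hc' : (c' : D) * γ = γ * c')
    (h : c • Submodule.span ℤ ({1, τ} : Set D) = c' • Submodule.span ℤ {1, τ'}) :
    (oform H.hdiv H.hγ τ).ProperEquiv (oform H.hdiv H.hγ τ') := by
  have h' : Submodule.span ℤ ({1, τ'} : Set D) = (c'⁻¹ * c) • Submodule.span ℤ {1, τ} := by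
    rw [mul_smul, h, smul_smul, inv_mul_cancel, one_smul]
  have hcc : ((c'⁻¹ * c : Dˣ) : D) * γ = γ * (c'⁻¹ * c : Dˣ) := by
    rw [Units.val_mul, mul_assoc, hc, ← mul_assoc, units_inv_comm hc', mul_assoc]
  obtain ⟨p, q, r, s, hdet, rfl⟩ := exists_moeb_of_span_eq_smul H.hdiv H.hγ hτ hτ'K hcc h'
  exact properEquiv_oform_moeb H.hdiv H.hγ H.himag hτK hτ hdet

/-- **The form class map `LatClass γ B → C(t² - 4n)`.** [cite: Cox2013, §7.B Thm. 7.7] -/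
def classMap : LatClass γ B → FormClass (t ^ 2 - 4 * n) :=
  Quotient.lift (fun L => Quotient.mk (formSetoid _) (H.formOf L)) (by
    rintro L L' ⟨c, hc, hLL'⟩
    apply Quotient.sound
    change (oform H.hdiv H.hγ (H.repτ L)).ProperEquiv (oform H.hdiv H.hγ (H.repτ L'))
    refine H.properEquiv_oform_of_smul_eq (H.repτ_mem L) (H.repτ_not_mem_bot L) (H.repτ_mem L')
      (c := c * H.repc L) (c' := H.repc L') ?_ (H.repc_comm L') ?_
    · rw [Units.val_mul, mul_assoc, H.repc_comm L, ← mul_assoc, hc, mul_assoc]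
    · rw [mul_smul, ← H.eq_repc_smul L, ← hLL', ← H.eq_repc_smul L'])

/-- **Injectivity of the form class map.** [cite: Cox2013, §7.B (proof of Thm. 7.7, injectivity)] -/
theorem classMap_injective : Function.Injective H.classMap := by
  intro x y hxy
  induction x using Quotient.inductionOn with
  | h L =>
  induction y using Quotient.inductionOn with
  | h L' =>
  have h : (oform H.hdiv H.hγ (H.repτ L)).ProperEquiv (oform H.hdiv H.hγ (H.repτ L')) := Quotient.exact hxy
  obtain ⟨p, q, r, s, hdet, he⟩ := h
  obtain ⟨p', q', r', s', hdet', he'⟩ :=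
    exists_moeb_oform_eq_act H.hdiv H.hγ H.himag (H.repτ_mem L) (H.repτ_not_mem_bot L) hdet
  rw [← he] at he'
  -- `τ_{L'} = ± moeb τ_L`
  have hrs : r' ≠ 0 ∨ s' ≠ 0 := by
    by_contra h; push Not at h; obtain ⟨rfl, rfl⟩ := h; simp at hdet'
  have hmK := moeb_mem_adjoin H.hdiv (H.repτ_mem L) (H.repτ_not_mem_bot L) p' q' hrs
  have hmnb := moeb_not_mem_bot H.hdiv H.hγ H.himag (H.repτ_mem L) (H.repτ_not_mem_bot L)
    (p := p') (q := q') (r := r') (s := s') (by rw [hdet']; exact one_ne_zero)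
  have hspan : Submodule.span ℤ ({1, H.repτ L'} : Set D) = Submodule.span ℤ {1, moeb (H.repτ L) p' q' r' s'} := by
    rcases eq_or_eq_neg_of_oform_eq H.hdiv H.hγ hmK hmnb (H.repτ_mem L') (H.repτ_not_mem_bot L') he' with e | e
    · rw [e]
    · rw [e, span_one_neg]
  obtain ⟨hz, hW⟩ := span_pair_moeb H.hdiv (H.repτ_not_mem_bot L) (p := p') (q := q') (Or.inl hdet')
  -- assemble the homothety `L' = c' W c⁻¹ L`
  apply Quotient.sound
  have hzK : (r' : D) * H.repτ L + (s' : D) ∈ Algebra.adjoin ℚ {γ} :=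
    Subalgebra.add_mem _ (Subalgebra.mul_mem _ (Subalgebra.intCast_mem _ r') (H.repτ_mem L)) (Subalgebra.intCast_mem _ s')
  have hWcomm : ((hz.unit⁻¹ : Dˣ) : D) * γ = γ * (hz.unit⁻¹ : Dˣ) :=
    units_inv_comm (by rw [hz.unit_spec]; exact comm_of_mem_adjoin hzK)
  refine ⟨H.repc L' * hz.unit⁻¹ * (H.repc L)⁻¹, ?_, ?_⟩
  · have h1 := H.repc_comm L'
    have h3 := units_inv_comm (H.repc_comm L)
    simp only [Units.val_mul]
    rw [mul_assoc, mul_assoc, h3, ← mul_assoc ((hz.unit⁻¹ : Dˣ) : D), hWcomm, mul_assoc,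
      ← mul_assoc (H.repc L' : D), h1]
    simp only [mul_assoc]
  · change (L' : Submodule ℤ D) = (H.repc L' * hz.unit⁻¹ * (H.repc L)⁻¹) • (L : Submodule ℤ D)
    rw [H.eq_repc_smul L', hspan, hW, mul_smul, mul_smul, H.eq_repc_smul L, smul_smul _ (H.repc L), inv_mul_cancel,
      one_smul]

/-- **Surjectivity of the form class map**: `f = (A, B, C)` is the oriented form of
`τ_f = (-B + √(t² - 4n))/(2A)` with `√(t² - 4n) = 2σ - t`, and `[1, τ_f]` is locally `B`-principal
since `A τ_f = σ - (t + B)/2`. [cite: Cox2013, §7.B (proof of Thm. 7.7, surjectivity: "τ = (-b + √D)/2a")] -/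
theorem classMap_surjective : Function.Surjective H.classMap := by
  classical
  haveI : Nontrivial D := nontrivial_of_isQuaternionAlgebra
  haveI : IsAddTorsionFree D := isAddTorsionFree_of_charZero_module ℚ D
  intro x
  induction x using Quotient.inductionOn with
  | h f =>
  obtain ⟨f, hf⟩ := f
  set A := f.a with hA
  set Bf := f.b with hBf
  set C := f.c with hC
  have hA0 : A ≠ 0 := hf.a_pos.ne'
  have hAQ : (A : ℚ) ≠ 0 := by exact_mod_cast hA0
  have hdisc : Bf ^ 2 - 4 * A * C = t ^ 2 - 4 * n := hf.disc_eq
  -- `t + B` is even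
  obtain ⟨k, hk⟩ : Even (t + Bf) := by
    have : Even ((t + Bf) * (t + Bf)) := ⟨2 * (A * C - n) + t * (t + Bf), by linear_combination hdisc⟩
    rcases Int.even_mul.mp this with h | h <;> exact h
  -- the root
  set τf : D := ((2 * A : ℚ))⁻¹ • ((2 : ℚ) • σ - algebraMap ℚ D ((t + Bf : ℤ) : ℚ)) with hτf
  have h2A : (2 * A : ℚ) ≠ 0 := mul_ne_zero two_ne_zero hAQ
  have hτfK : τf ∈ Algebra.adjoin ℚ {γ} :=
    Subalgebra.smul_mem _ (Subalgebra.sub_mem _ (Subalgebra.smul_mem _ H.σ_mem_adjoin _) (Subalgebra.algebraMap_mem _ _)) _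
  have hqIm : qIm H.hdiv H.hγ τf = (2 * A : ℚ)⁻¹ * (2 * (m : ℚ)⁻¹) := by
    rw [hτf, qIm_smul H.hdiv H.hγ (Subalgebra.sub_mem _ (Subalgebra.smul_mem _ H.σ_mem_adjoin _)
      (Subalgebra.algebraMap_mem _ _)), sub_eq_add_neg,
      qIm_add H.hdiv H.hγ (Subalgebra.smul_mem _ H.σ_mem_adjoin _) (Subalgebra.neg_mem _ (Subalgebra.algebraMap_mem _ _)),
      qIm_smul H.hdiv H.hγ H.σ_mem_adjoin, H.qIm_σ, qIm_neg H.hdiv H.hγ (Subalgebra.algebraMap_mem _ _),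
      qIm_algebraMap, neg_zero, add_zero]
  have hqIm_pos : 0 < qIm H.hdiv H.hγ τf := by
    rw [hqIm]
    have hApos : (0 : ℚ) < A := by exact_mod_cast hf.a_pos
    have hmpos : (0 : ℚ) < m := by exact_mod_cast Nat.pos_of_ne_zero H.hm
    positivity
  have hτfnb : τf ∉ (⊥ : Subalgebra ℚ D) := fun h => by
    rw [mem_bot_iff_qIm_eq_zero H.hdiv H.hγ hτfK] at h
    rw [h] at hqIm_pos
    exact lt_irrefl _ hqIm_pos
  -- `A τ_f = σ - k`
  have hAτ : A • τf = σ + ((-k : ℤ) : D) := by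
    rw [← Int.cast_smul_eq_zsmul ℚ, hτf, smul_smul, smul_sub, smul_smul, hk,
      Algebra.smul_def _ (algebraMap ℚ D _), ← map_mul]
    have e1 : (A : ℚ) * (2 * (A : ℚ))⁻¹ * 2 = 1 := by field_simp
    have e2 : (A : ℚ) * (2 * (A : ℚ))⁻¹ * ((k + k : ℤ) : ℚ) = k := by push_cast; field_simp; ring
    rw [e1, one_smul, e2, map_intCast, Int.cast_neg, sub_eq_add_neg]
  -- `τ_f` is a root of `f`
  have hroot : IsRootOf τf f := by
    have hσ2 : σ * σ = (t : ℚ) • σ - (n : ℚ) • (1 : D) := by rw [H.hsq, Algebra.algebraMap_eq_smul_one]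
    have hdiscQ : ((Bf : ℚ)) ^ 2 - 4 * A * C = t ^ 2 - 4 * n := by exact_mod_cast hdisc
    unfold IsRootOf
    rw [← hA, ← hBf, ← hC, hτf, Algebra.algebraMap_eq_smul_one, Algebra.algebraMap_eq_smul_one]
    push_cast
    simp only [smul_sub, smul_smul, sub_mul, mul_sub, smul_mul_assoc, mul_smul_comm, mul_one, one_mul, hσ2]
    match_scalars
    · field_simp
      ring
    · field_simp
      linear_combination -hdiscQ
  have hprim : primForm τf = f := (eq_primForm hτfnb hroot hf.primitive hf.a_pos).symm
  have hoform : oform H.hdiv H.hγ τf = f := by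
    unfold oform; rw [if_pos hqIm_pos, hprim]
  -- local principality of `[1, τ_f]`
  have hLP : IsLocPrin γ B (Submodule.span ℤ {1, τf}) := by
    rw [isLocPrin_iff_eq_span H.hdiv H.hB hτfK hτfnb, hprim, ← hA, hAτ, span_one_add_int, ← H.eq_span]
  set Lf : locPrinLattices γ B := ⟨Submodule.span ℤ {1, τf}, isKLattice_span_pair H.hdiv H.hγ hτfK hτfnb, hLP⟩
  refine ⟨Quotient.mk _ Lf, ?_⟩
  change Quotient.mk (formSetoid _) (H.formOf Lf) = _
  apply Quotient.sound
  change (oform H.hdiv H.hγ (H.repτ Lf)).ProperEquiv f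
  rw [← hoform]
  refine (H.properEquiv_oform_of_smul_eq hτfK hτfnb (H.repτ_mem Lf) (c := 1) (c' := H.repc Lf) (by simp)
    (H.repc_comm Lf) ?_).symm
  rw [one_smul, ← H.eq_repc_smul Lf]

/-- **The form class map is a bijection `LatClass γ B ≃ C(t² - 4n)`.** [cite: Cox2013, §7.B Thm. 7.7] -/
theorem classMap_bijective : Function.Bijective H.classMap := ⟨H.classMap_injective, H.classMap_surjective⟩

/-- **`h(B) = h(t² - 4n)`**: the idelic class number of the order `B = ℤ[σ]` of discriminant
`t² - 4n` in `ℚ(γ)` is the number of classes of primitive positive definite forms of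
discriminant `t² - 4n` (Cox Thm. 7.7(ii) for an arbitrary order, with idele classes in place of
`Pic`; counted by reduced forms, Thm. 2.13). [cite: Cox2013, §7.B Thm. 7.7, §7.C, §2.A Thm. 2.13] -/
theorem classNumber_eq : classNumber γ B = BinQF.classNumber (t ^ 2 - 4 * n) := by
  rw [classNumber_eq_card_latClass H.hdiv H.hγ H.hB, Nat.card_congr (Equiv.ofBijective _ H.classMap_bijective),
    card_formClass H.disc_neg]

end PicHyp

end Brandt

end Literature.NumberTheory.Automorphic

end
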